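import Summits.BirchSwinnertonDyer.BirchSwinnertonDyer.Theorems.PrintX11aUpperNonSurjThreeMultDivisibilityAtOfConjA
import HarnessLib

/-!
# Route `PrintX11a`, crux U3 `UpperNonSurjThree` (item stmt-BirchSwinnertonDyer-20613), line «finemu3»: the GRADED,
# (A)-FREE transfer at a multiplicative odd prime — Kato's divisibility is INTEGRAL UP TO `p^{μ(X₀(E/ℚ_∞))}`

Seat `bsd-line-x11a-p2` (D-0154 KEY (146)/(147)(e)); `--supports stmt-BirchSwinnertonDyer-20613` (helper). Theses-free.
BSD is not proved by any of this; nothing is asserted about any curve; every theorem is CONDITIONAL on its displayed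
hypotheses (the same seven Kato/Greenberg/Wuthrich facts as p606949 — three CONSTRUCTION facts, flags
`Kato-17.11-at-{nonsplit,split}-mult`, `Kato-p280-image-at-mult`, R-48 ride on THEM).

WHAT. p606949 proved `(A) at the pair ⟹ ϖ·L ∈ char_Λ X(E/ℚ_∞)` at `p ∥ N`, `E[p]` irreducible. The same height-one
count WITHOUT any hypothesis on the fine Selmer group gives the GRADED statement: for EVERY dual fine Selmer datum `Y`
(`Y.X = X₀(E/ℚ_∞)`, a quotient of the torsion module `X`, so `μ(Y.X)` is meaningful),

  `C(p)^{μ(Y.X)} · ϖ·L ∈ ι(char_Λ X)`  (non-split),   `C(p)^{μ(Y.X)} · ϖ·L ∈ T · ι(char_Λ X)`  (split),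

i.e. the defect of integrality of Kato's `⊗ℚ` divisibility at a multiplicative prime is AT MOST the `μ`-invariant of the
fine Selmer group — the multiplicative-prime twin of the cell bsd-f3-mu's carrier `Rank1Residual.MuDefectLeFineMuAt`
(«`k ≤ μ(X₀)`», proved at good ordinary `p` in `SmallImageMu/MuDefectLeFineMu.lean`). NO image hypothesis beyond `Irr`,
NO `μ = 0` of any kind, NO (ram), NO BCS. Consequences: §3 the transfer from the POINTWISE fine carrier
`Rank1Residual.FineMuZeroAt W p` (`μ(X₀) = 0`; weaker-looking than (A), fed by the f3-mu certificate predicates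
`FineSelmerTrivialAt`, Ray–Sujatha, first-layer criteria) — `X11b.multDivisibilityAt_of_katoFacts_of_fineMuZeroAt` —
and p606949's (A)-form recovered from it (reading aid).

PROOF. `H ∈ Λ` with `C(ϖ.num)·g = C(ϖ.den·pⁿ)·H`, `G = t·H` (`t = 1` resp. `T`), `g ∈ char X` (Kato `⊗ℚ`); claim
`C(p)^k·H ∈ char X` for `k = μ(Y.X)`: at `𝔭 = (p)` the chart inequality `ℓ(X) ≤ ℓ(Λ/(G)) + ℓ(Y.X)`
(`MultFineMu.lengthAt_X_le_add_of_mult`, p606949) and `ℓ_(p)(Y.X) = k = ℓ_(p)(Λ/(C(p)^k))`; off `(p)` the rational bound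
(`MultFineMu.lengthAt_le_of_mem_charIdeal_of_C_mul_eq`) and `C(p)^k ∉ 𝔭`; glue by `Module.mem_charIdeal_of_lengthAt_le`.

HONEST FRAMING. Theorems only (no `def`, no named fact, no `sorry`); item 20613 does NOT close (its residual is (A) /
`μ(X₀) = 0` CLASS-WIDE on the U3 domain — OPEN); PARTITION 0; beyond-print theorem: the graded integrality
`char X ∣ p^{μ(X₀)}·ϖ·L_p` at `p ∥ N` without (12.5.4) (Kato Thm. 17.4 gives `∣ pⁿ·L` for SOME `n`; here `n ≤ μ(X₀)`).

References: [Kato2004Asterisque] Thm. 12.4–12.6 (pp. 221–222), (14.9.3) (p. 240), Thm. 17.4 (p. 273), §17.13 (pp. 279–280);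
[CoatesSujatha2005] §3 statement (A); [Wuthrich2014] Cor. 18 (p. 398); [Washington1997] §13.2; tree p606949
(`MultFineMu.*`), `Rank1Residual/MuLambdaCarriers.lean` (`FineMuZeroAt`, `MuDefectLeFineMuAt`), `SmallImageMu/MuDefectLeFineMu.lean`.
-/

set_option autoImplicit false
set_option linter.dupNamespace false

noncomputable section

open scoped Classical NumberField MatrixGroups ModularForm

open CongruenceSubgroup WeierstrassCurve Field IsDedekindDomain Literature.NumberTheory.GaloisRepresentations
  Literature.NumberTheory.EllipticCurves Literature.NumberTheory.EllipticCurves.ModularForms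
  Literature.NumberTheory.EllipticCurves.Kato2004 Literature.NumberTheory.EllipticCurves.Rank1Residual
  Literature.NumberTheory.EllipticCurves.Rank1Residual.Typed Literature.NumberTheory.EllipticCurves.Wuthrich2014
  Literature.NumberTheory.EllipticCurves.Greenberg1999 Summit.BirchSwinnertonDyer.Rank1Residual
  Summit.BirchSwinnertonDyer.Rank1Residual.X5.O1 Summit.BirchSwinnertonDyer.BirchSwinnertonDyer.Rank1Residual

namespace Summit.BirchSwinnertonDyer.Rank1Residual.X11b.MultFineMu

open Module IwasawaAlgebra

/-! ### §1 The graded core: `C(p)^{μ(Y)}·H ∈ char_Λ X` -/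

section Core

variable {p : ℕ} [Fact p.Prime]

/-- `ℓ_𝔭(Λ/(C(p)^k·H)) = k + ℓ_𝔭(Λ/(H))` at `𝔭 = (p)` (additivity of local lengths of cyclic quotients,
`ℓ_(p)(Λ/(p)) = 1`). [cite: Washington1997, §13.2] -/
theorem lengthAt_quotient_C_pow_mul (k : ℕ) (H : IwasawaAlgebra p) (𝔭 : PrimeSpectrum (IwasawaAlgebra p))
    (h𝔭 : 𝔭.asIdeal = augIdealP p) :
    lengthAt (IwasawaAlgebra p) (IwasawaAlgebra p ⧸ Ideal.span {PowerSeries.C (p : ℤ_[p]) ^ k * H}) 𝔭 =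
      k + lengthAt (IwasawaAlgebra p) (IwasawaAlgebra p ⧸ Ideal.span {H}) 𝔭 := by
  have hC : (PowerSeries.C (p : ℤ_[p]) : IwasawaAlgebra p) ≠ 0 := (IwasawaAlgebra.prime_C p).ne_zero
  have h1 : lengthAt (IwasawaAlgebra p) (IwasawaAlgebra p ⧸ Ideal.span {PowerSeries.C (p : ℤ_[p])}) 𝔭 = 1 := by
    have h : Ideal.span {PowerSeries.C (p : ℤ_[p])} = 𝔭.asIdeal := by rw [h𝔭]; rfl
    rw [h]
    exact lengthAt_quotient_self 𝔭
  rw [lengthAt_quotient_span_singleton_mul H (pow_ne_zero k hC) 𝔭,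
    lengthAt_quotient_span_singleton_pow hC k 𝔭, h1]
  simp

variable {W : WeierstrassCurve ℚ} [W.IsElliptic]
  [ContinuousSMul ℤ_[p] (W.tateModule p)] {L : PowerSeries ℚ_[p]}
  {κ : ZpExtension ℚ p} {γ : absoluteGaloisGroup ℚ}
  {I : IwasawaH1Data W p κ γ} {D : W.SelmerDualData κ γ} {Y : W.FineSelmerDualData κ γ}

/-- **THE GRADED CORE (no hypothesis on the fine Selmer group).** Data as in
`mem_charIdeal_of_multFine_of_fineMuZero` (p606949) minus `μ(Y.X) = 0`: a multiplicative §17.13 package `K` with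
`toX ∘ loc = 0`, a SURJECTIVE fine quotient `π : X ↠ Y.X` exact after `P → X`, `X` f.g. torsion, the p. 280 image
clause for `G` at every height-one prime, `G = t·H` with `t ∉ (p)`, and the rational divisibility `g ∈ char X`,
`C(a)·g = C(b)·H` (`a, b ≠ 0`).  Conclusion: **`C(p)^{μ(Y.X)} · H ∈ char_Λ X`** — at `(p)`:
`ℓ(X) ≤ ℓ(Λ/(G)) + ℓ(Y.X) = ℓ(Λ/(H)) + μ(Y.X) = ℓ(Λ/(C(p)^μ·H))`; off `(p)`: the rational bound and `C(p)^μ ∉ 𝔭`.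
[cite: Kato2004Asterisque, Thm. 17.4 (p. 273) and §17.13 (pp. 279–280)] [cite: Washington1997, §13.2] -/
theorem C_pow_mu_mul_mem_charIdeal_of_multFine (K : MultDivisibilityInputs W p L κ γ I D)
    (hloc0 : ∀ h : I.H, K.toX (K.loc h) = 0)
    (π : D.X →ₗ[IwasawaAlgebra p] Y.X) (hπs : Function.Surjective π) (hπ : Function.Exact K.toX π)
    [Module.Finite (IwasawaAlgebra p) D.X] (hX : D.IsTorsion)
    {G H g t : IwasawaAlgebra p} {a b : ℤ_[p]}
    (himg : ∀ 𝔭 : PrimeSpectrum (IwasawaAlgebra p), 𝔭.asIdeal.height = 1 →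
      ∃ s : IwasawaAlgebra p, s ∉ 𝔭.asIdeal ∧ s * G ∈ Submodule.map (K.col ∘ₗ K.loc) K.Z)
    (hGH : G = t * H) (ht : t ∉ augIdealP p)
    (hg : g ∈ D.charIdeal) (ha : a ≠ 0) (hb : b ≠ 0)
    (hrel : PowerSeries.C a * g = PowerSeries.C b * H) :
    PowerSeries.C (p : ℤ_[p]) ^ muInvariant p Y.X * H ∈ D.charIdeal := by
  by_cases hH0 : H = 0
  · subst hH0; rw [mul_zero]; exact Submodule.zero_mem _
  haveI : Module.Finite (IwasawaAlgebra p) Y.X := Module.Finite.of_surjective π hπs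
  have hYt : Module.IsTorsion (IwasawaAlgebra p) Y.X := by
    intro y
    obtain ⟨x, rfl⟩ := hπs y
    obtain ⟨c, hc⟩ := @hX x
    exact ⟨c, by rw [Submonoid.smul_def, ← map_smul, ← Submonoid.smul_def, hc, map_zero]⟩
  have hC : (PowerSeries.C (p : ℤ_[p]) : IwasawaAlgebra p) ≠ 0 := (IwasawaAlgebra.prime_C p).ne_zero
  have hCH : PowerSeries.C (p : ℤ_[p]) ^ muInvariant p Y.X * H ≠ 0 := mul_ne_zero (pow_ne_zero _ hC) hH0
  refine Module.mem_charIdeal_of_lengthAt_le hX hCH fun 𝔭 h𝔭1 ↦ ?_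
  by_cases hp𝔭 : PowerSeries.C (p : ℤ_[p]) ∈ 𝔭.asIdeal
  · -- `𝔭 = (p)`: the chart inequality, `ℓ_(p)(Y.X) = μ(Y.X)`, `ℓ_(p)(Λ/(t·H)) = ℓ_(p)(Λ/(H))`
    have h𝔭 : 𝔭.asIdeal = augIdealP p := ZetaImage.eq_augIdealP_of_height_eq_one_of_C_mem 𝔭 h𝔭1 hp𝔭
    have hYμ : lengthAt (IwasawaAlgebra p) Y.X 𝔭 = muInvariant p Y.X := by
      rw [muInvariant_eq_toNat_lengthAt p Y.X 𝔭 h𝔭, ENat.coe_toNat (lengthAt_ne_top_of_isTorsion p Y.X hYt 𝔭 h𝔭)]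
    have ht𝔭 : t ∉ 𝔭.asIdeal := h𝔭 ▸ ht
    calc lengthAt (IwasawaAlgebra p) D.X 𝔭
        ≤ lengthAt (IwasawaAlgebra p) (IwasawaAlgebra p ⧸ Ideal.span {G}) 𝔭 +
            lengthAt (IwasawaAlgebra p) Y.X 𝔭 :=
          lengthAt_X_le_add_of_mult K hloc0 𝔭 (himg 𝔭 h𝔭1) π hπ
      _ = lengthAt (IwasawaAlgebra p)
            (IwasawaAlgebra p ⧸ Ideal.span {PowerSeries.C (p : ℤ_[p]) ^ muInvariant p Y.X * H}) 𝔭 := by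
          rw [hYμ, hGH, lengthAt_quotient_span_mul_eq_of_not_mem H 𝔭 ht𝔭, lengthAt_quotient_C_pow_mul _ H 𝔭 h𝔭,
            add_comm]
  · -- `𝔭 ∌ p`: the rational divisibility; `C(p)^μ = C(p^μ)` is a unit at `𝔭`
    have hpow : (PowerSeries.C (p : ℤ_[p]) : IwasawaAlgebra p) ^ muInvariant p Y.X =
        PowerSeries.C ((p : ℤ_[p]) ^ muInvariant p Y.X) := (map_pow _ _ _).symm
    have hnot : PowerSeries.C ((p : ℤ_[p]) ^ muInvariant p Y.X) ∉ 𝔭.asIdeal :=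
      C_not_mem_of_C_p_not_mem (pow_ne_zero _ (by exact_mod_cast (Fact.out : p.Prime).ne_zero)) 𝔭 hp𝔭
    rw [hpow, lengthAt_quotient_span_mul_eq_of_not_mem H 𝔭 hnot]
    exact lengthAt_le_of_mem_charIdeal_of_C_mul_eq hX ha hb hg hrel hH0 𝔭 h𝔭1 hp𝔭

end Core

end MultFineMu

/-! ### §2 The graded transfer at a multiplicative odd prime: integrality up to `p^{μ(X₀)}` -/

/-- **GRADED KATO DIVISIBILITY AT `p ∥ N`, NO (A), NO IMAGE HYPOTHESIS BEYOND `Irr`.** For a globally minimal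
elliptic `W/ℚ`, an ODD prime `p` of MULTIPLICATIVE reduction with `E[p]` irreducible, modulo the seven displayed
facts: for every cyclotomic datum, newform `f`, Selmer dual datum `D`, `ϖ ≠ 0` with `ϖ·Ω_E = Ω⁺_f`, and EVERY dual
fine Selmer datum `Y` (`Y.X = X₀(E/ℚ_∞)`; all are isomorphic): `X` is torsion, and
* non-split: for THE MTT function `L` (`a = −1`) and every `G ∈ Λ` with `ι G = ϖ·L`, `C(p)^{μ(Y.X)}·G ∈ char_Λ X`;
* split: for every `L` with `IsSplitMultPAdicLFunctionOf f p L` and `G` with `ι G = ϖ·L`, `G = T·G'` with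
  `C(p)^{μ(Y.X)}·G' ∈ char_Λ X`.
So `char X ∣ p^{μ(X₀)}·ϖ·L_p` (resp. `T·char X ∣ …`): Kato's Thm. 17.4 (2) `∣ pⁿ·L` with the exponent BOUNDED by the
fine `μ`-invariant; `μ(X₀) = 0` ((A), or `FineMuZeroAt`) gives `X11b.MultDivisibilityAt` (§3, p606949).
[cite: Kato2004Asterisque, Thm. 12.4 (p. 221), (14.9.3) (p. 240), Thm. 17.4 (p. 273), §17.13 (pp. 279–280)]
[cite: Wuthrich2014, p. 391 and Cor. 18 (p. 398)] [cite: GreenbergLNM1716, Thm. 1.5 (p. 61)] [cite: Washington1997, §13.2] -/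
theorem C_pow_fineMu_mul_mem_charIdeal_of_katoFacts
    (hne : Kato2004.nonempty_iwasawaH1Data) (h12 : Kato2004.thm12_4)
    (hns : Kato2004.exists_multDivisibilityInputs_nonsplit)
    (hsp : Kato2004.exists_multDivisibilityInputs_split)
    (h15 : thm15_isTorsion_multiplicative_rat)
    (hfine : Kato2004.exists_multDivisibilityInputs_fine)
    (W : WeierstrassCurve ℚ) [W.IsElliptic] [W.IsGloballyMinimal] (p : ℕ) [Fact p.Prime]
    (hp : p ≠ 2) (hmult : Mult W p) (hirr : Irr W p)
    {κ : ZpExtension ℚ p} {γ : absoluteGaloisGroup ℚ} {N : ℕ} [NeZero N] {f : CuspForm (Gamma0 N) 2}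
    (hκ : κ.IsCyclotomic) (hγ : κ.IsTopGenerator γ) (hγ' : IsCyclotomicVariable p γ) (hf : IsNewformOf W f)
    (D : W.SelmerDualData κ γ) (Y : W.FineSelmerDualData κ γ)
    (ϖ : ℚ) (hϖ0 : ϖ ≠ 0) (hϖ : (ϖ : ℝ) * W.realPeriodRat = plusPeriod f) :
    D.IsTorsion ∧
    (¬ W.HasSplitMultiplicativeReductionAtPrime p →
      ∀ L : PowerSeries ℚ_[p], IsMultPAdicLFunctionOf f p (-1) L →
        ∀ G : IwasawaAlgebra p, iwasawaToPowerSeries p G = PowerSeries.C ((ϖ : ℚ) : ℚ_[p]) * L →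
          PowerSeries.C (p : ℤ_[p]) ^ muInvariant p Y.X * G ∈ D.charIdeal) ∧
    (W.HasSplitMultiplicativeReductionAtPrime p →
      ∀ L : PowerSeries ℚ_[p], IsSplitMultPAdicLFunctionOf f p L →
        ∀ G : IwasawaAlgebra p, iwasawaToPowerSeries p G = PowerSeries.C ((ϖ : ℚ) : ℚ_[p]) * L →
          ∃ G' : IwasawaAlgebra p, G = PowerSeries.X * G' ∧
            PowerSeries.C (p : ℤ_[p]) ^ muInvariant p Y.X * G' ∈ D.charIdeal) := by
  have hK : KatoMultiplicativeDivisibilityRat W p :=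
    Summit.BirchSwinnertonDyer.BirchSwinnertonDyer.Theorems.MultKatoRat.katoMultiplicativeDivisibilityRat_of_facts_odd
      W p hp hne h12 hns hsp h15
  haveI : ContinuousSMul ℤ_[p] (W.tateModule p) := TateModule.continuousSMul_padicInt
  haveI : Module.Free ℤ_[p] (W.tateModule p) := W.module_free_tateModule_holds p
  haveI : Module.Finite ℤ_[p] (W.tateModule p) := W.module_finite_tateModule_holds p
  haveI : Module.Finite (IwasawaAlgebra p) D.X :=
    WeierstrassCurve.SelmerDualData.module_finite_of_isCyclotomic W κ hκ D hγ
  obtain ⟨hX, hnsK, hsK⟩ := hK κ γ hκ hγ hγ' hmult f hf D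
  obtain ⟨I⟩ := hne W p κ γ hκ hγ
  have hnum : ((ϖ.num : ℤ) : ℤ_[p]) ≠ 0 := by
    exact_mod_cast Rat.num_ne_zero.mpr hϖ0
  have hden : ∀ n : ℕ, ((ϖ.den : ℕ) : ℤ_[p]) * (p : ℤ_[p]) ^ n ≠ 0 := fun n ↦
    mul_ne_zero (by exact_mod_cast ϖ.den_nz) (pow_ne_zero n (by exact_mod_cast (Fact.out : p.Prime).ne_zero))
  refine ⟨hX, fun hn L hL G hG ↦ ?_, fun hsplit L hL G hG ↦ ?_⟩
  · obtain ⟨n, g, hg, hι⟩ := hnsK hn L hL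
    obtain ⟨K, π, hloc0, hπs, hπ, -, himg⟩ :=
      hfine W p f κ γ hp hmult hκ hγ hγ' hf (-1) L (fun hs ↦ absurd hs hn) (fun _ ↦ rfl) hL I D Y
    exact MultFineMu.C_pow_mu_mul_mem_charIdeal_of_multFine K hloc0 π hπs hπ hX
      (fun 𝔭 h1 ↦ by
        obtain ⟨s, hs, hsG, -⟩ := himg hirr G ϖ hϖ hG 𝔭 h1
        exact ⟨s, hs, hsG⟩)
      (one_mul G).symm (fun h ↦ (IwasawaAlgebra.isPrime_augIdealP_holds p).ne_top ((Ideal.eq_top_iff_one _).mpr h))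
      hg hnum (hden n) (MultFineMu.C_num_mul_eq_C_den_mul hι hG)
  · have hL1 : IsMultPAdicLFunctionOf f p 1 L := (isMultPAdicLFunctionOf_one_iff L).mpr hL
    obtain ⟨n, g, hg, hι⟩ := hsK hsplit L hL
    obtain ⟨K, π, hloc0, hπs, hπ, -, himg⟩ :=
      hfine W p f κ γ hp hmult hκ hγ hγ' hf 1 L (fun _ ↦ rfl) (fun hns' ↦ absurd hsplit hns') hL1 I D Y
    have hrel := MultFineMu.C_num_mul_eq_C_den_mul hι hG
    have hXdvd : (PowerSeries.X : IwasawaAlgebra p) ∣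
        PowerSeries.C (((ϖ.den : ℕ) : ℤ_[p]) * (p : ℤ_[p]) ^ n) * G :=
      ⟨PowerSeries.C ((ϖ.num : ℤ) : ℤ_[p]) * g, by rw [← hrel]; ring⟩
    have hXG : (PowerSeries.X : IwasawaAlgebra p) ∣ G := by
      refine (PowerSeries.X_prime.dvd_or_dvd hXdvd).resolve_left fun h ↦ hden n ?_
      rwa [PowerSeries.X_dvd_iff, PowerSeries.constantCoeff_C] at h
    obtain ⟨G', rfl⟩ := hXG
    have hrel' : PowerSeries.C ((ϖ.num : ℤ) : ℤ_[p]) * g =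
        PowerSeries.C (((ϖ.den : ℕ) : ℤ_[p]) * (p : ℤ_[p]) ^ n) * G' :=
      mul_left_cancel₀ (PowerSeries.X_ne_zero (R := ℤ_[p])) (by rw [← mul_assoc, ← mul_assoc,
        mul_comm PowerSeries.X, mul_comm PowerSeries.X, mul_assoc, hrel, mul_assoc])
    refine ⟨G', rfl, ?_⟩
    exact MultFineMu.C_pow_mu_mul_mem_charIdeal_of_multFine K hloc0 π hπs hπ hX
      (fun 𝔭 h1 ↦ by
        obtain ⟨s, hs, hsG, -⟩ := himg hirr (PowerSeries.X * G') ϖ hϖ hG 𝔭 h1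
        exact ⟨s, hs, hsG⟩)
      rfl ZetaImage.X_notMem_augIdealP hg hnum (hden n) hrel'

/-! ### §3 The transfer from the POINTWISE fine carrier `FineMuZeroAt` (`μ(X₀) = 0`), and (A) recovered -/

/-- **`X11b.MultDivisibilityAt W p` from `Rank1Residual.FineMuZeroAt W p`** (pointwise `μ(X₀(E/ℚ_∞)) = 0`, the
f3-mu cell's fine carrier — fed by `FineSelmerTrivialAt.fineMuZeroAt`, `fineMuZeroAt_of_raySujathaCert`, the
first-layer criteria, `ConjAAt.fineMuZeroAt`) at an odd multiplicative pair with `E[p]` irreducible, modulo the seven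
displayed facts: the exponent of §2 vanishes.  NO (A) needed as such, NO image bit, NO (ram).
[cite: Kato2004Asterisque, Thm. 17.4 (p. 273) and §17.13 (pp. 279–280)] [cite: Wuthrich2014, Cor. 18 (p. 398)]
[cite: CoatesSujatha2005, §3 statement (A) (μ-form)] -/
theorem multDivisibilityAt_of_katoFacts_of_fineMuZeroAt
    (hne : Kato2004.nonempty_iwasawaH1Data) (h12 : Kato2004.thm12_4)
    (hns : Kato2004.exists_multDivisibilityInputs_nonsplit)
    (hsp : Kato2004.exists_multDivisibilityInputs_split)
    (h15 : thm15_isTorsion_multiplicative_rat)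
    (h18 : Wuthrich2014.corollary18_padicLFunction_mem_iwasawaAlgebra_multiplicative)
    (hfine : Kato2004.exists_multDivisibilityInputs_fine)
    (W : WeierstrassCurve ℚ) [W.IsElliptic] [W.IsGloballyMinimal] (p : ℕ) [Fact p.Prime]
    (hp : p ≠ 2) (hmult : Mult W p) (hirr : Irr W p) (hF : FineMuZeroAt W p) :
    MultDivisibilityAt W p := by
  intro κ γ N _ f hκ hγ hγ' hf D ϖ hϖ0 hϖ
  obtain ⟨Y⟩ := W.nonempty_fineSelmerDualData κ hγ
  obtain ⟨hX, hnsG, hsG⟩ := C_pow_fineMu_mul_mem_charIdeal_of_katoFacts hne h12 hns hsp h15 hfine W p hp hmult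
    hirr hκ hγ hγ' hf D Y ϖ hϖ0 hϖ
  obtain ⟨hint_ns, hint_s⟩ := h18 W p hp hmult hf ϖ hϖ
  -- `μ(Y.X) = 0`: `Y.X` is a quotient of the torsion module `X` through Kato's fine package
  haveI : ContinuousSMul ℤ_[p] (W.tateModule p) := TateModule.continuousSMul_padicInt
  haveI : Module.Free ℤ_[p] (W.tateModule p) := W.module_free_tateModule_holds p
  haveI : Module.Finite ℤ_[p] (W.tateModule p) := W.module_finite_tateModule_holds p
  haveI : Module.Finite (IwasawaAlgebra p) D.X :=
    WeierstrassCurve.SelmerDualData.module_finite_of_isCyclotomic W κ hκ D hγ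
  obtain ⟨I⟩ := hne W p κ γ hκ hγ
  -- `μ(Y.X) = 0` once SOME `Λ`-linear surjection `X ↠ Y.X` is in hand (Kato's fine package supplies one per `L`)
  have hμ0 : ∀ π : D.X →ₗ[IwasawaAlgebra p] Y.X, Function.Surjective π → muInvariant p Y.X = 0 := by
    intro π hπs
    haveI : Module.Finite (IwasawaAlgebra p) Y.X := Module.Finite.of_surjective π hπs
    have hYt : Module.IsTorsion (IwasawaAlgebra p) Y.X := by
      intro y
      obtain ⟨x, rfl⟩ := hπs y
      obtain ⟨c, hc⟩ := @hX x
      exact ⟨c, by rw [Submonoid.smul_def, ← map_smul, ← Submonoid.smul_def, hc, map_zero]⟩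
    exact hF κ γ hκ hγ hγ' Y inferInstance hYt
  refine ⟨hX, fun hn L hL ↦ ?_, fun hsplit L hL ↦ ?_⟩
  · obtain ⟨G, hG⟩ := hint_ns hn L hL
    obtain ⟨K, π, -, hπs, -⟩ :=
      hfine W p f κ γ hp hmult hκ hγ hγ' hf (-1) L (fun hs ↦ absurd hs hn) (fun _ ↦ rfl) hL I D Y
    have h := hnsG hn L hL G hG
    rw [hμ0 π hπs, pow_zero, one_mul] at h
    exact ⟨G, h, hG⟩
  · obtain ⟨G, hG⟩ := hint_s hsplit L hL
    obtain ⟨K, π, -, hπs, -⟩ := hfine W p f κ γ hp hmult hκ hγ hγ' hf 1 L (fun _ ↦ rfl)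
      (fun hns' ↦ absurd hsplit hns') ((isMultPAdicLFunctionOf_one_iff L).mpr hL) I D Y
    obtain ⟨G', rfl, h⟩ := hsG hsplit L hL G hG
    rw [hμ0 π hπs, pow_zero, one_mul] at h
    exact ⟨G', h, hG⟩

/-- **(A)-form recovered** (reading aid; = p606949's `multDivisibilityAt_of_katoFacts_of_conjAAt` through
`ConjAAt.fineMuZeroAt`). [cite: CoatesSujatha2005, §3 statement (A)] [cite: Kato2004Asterisque, §17.13 (pp. 279–280)] -/
theorem multDivisibilityAt_of_katoFacts_of_conjAAt'
    (hne : Kato2004.nonempty_iwasawaH1Data) (h12 : Kato2004.thm12_4)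
    (hns : Kato2004.exists_multDivisibilityInputs_nonsplit)
    (hsp : Kato2004.exists_multDivisibilityInputs_split)
    (h15 : thm15_isTorsion_multiplicative_rat)
    (h18 : Wuthrich2014.corollary18_padicLFunction_mem_iwasawaAlgebra_multiplicative)
    (hfine : Kato2004.exists_multDivisibilityInputs_fine)
    (W : WeierstrassCurve ℚ) [W.IsElliptic] [W.IsGloballyMinimal] (p : ℕ) [Fact p.Prime]
    (hp : p ≠ 2) (hmult : Mult W p) (hirr : Irr W p) (hA : ConjAAt W p) :
    MultDivisibilityAt W p :=
  multDivisibilityAt_of_katoFacts_of_fineMuZeroAt hne h12 hns hsp h15 h18 hfine W p hp hmult hirr hA.fineMuZeroAt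

end Summit.BirchSwinnertonDyer.Rank1Residual.X11b

end
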